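import Literature.MathematicalPhysics.QuantumFieldTheory.LatticeLangevinDynamics
import Mathlib.Analysis.Normed.Algebra.MatrixExponential
import HarnessLib

/-!
# Route `ColdStartUniversality` (fixed-cut-off package; brick «G3» of GAUGE COVARIANCE IN LAW of the SZZ dynamics):
# the SDE data of `latticeLangevinDynamics` are GAUGE COVARIANT — algebra of `Ad_{ρ(g)}` on `(M_N(ℂ), Re tr(X Yᴴ))`

Helper file (seat `ym-line-csu-p1`, g10; `--supports stmt-QuantumFields-24809`).  For a lattice representation datum `r` (`ρ(G) ≤ U(N)`)
and the conjugation `X ↦ ρ(g) X ρ(g)ᴴ`: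

* `hsForm_conj` — `Ad_{ρ(g)}` is an isometry of the Hilbert–Schmidt form; `conj_mem_lieAlg`, `conj_mem_orthogonal` — it preserves `𝔤`
  and `𝔤^⊥`; `lieProj_conj` — ★ the projection `𝐩` is `Ad`-EQUIVARIANT: `𝐩(ρ(g) X ρ(g)ᴴ) = ρ(g) 𝐩(X) ρ(g)ᴴ`;
* `hsForm_eq_sum` (Parseval in the basis `Eₙ = noiseDir n`), `sum_adCoeff_mul_adCoeff` — the matrix
  `R_{mn} = ⟨ρ(g) Eₙ ρ(g)ᴴ, E_m⟩` of `Ad_{ρ(g)}` is ORTHOGONAL (`Σ_m R_{mn} R_{mn'} = δ_{nn'}`, and as matrices `Rᵀ R = 1`);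
* `casimir_conj` — the Casimir matrix is `Ad`-invariant;
* `rootedLoop_gauge` — under the lattice gauge action `Q_e ↦ ρ(h_x) Q_e ρ(h_{x+e})ᴴ` the plaquette loops rooted at `e = (x, i)` are
  conjugated by `ρ(h_x)`; `driftLie_gauge`, ★ `drift_gauge` — the SZZ drift is covariant:
  `b_e(Q^h) = ρ(h_x) b_e(Q) ρ(h_{x+eᵢ})ᴴ`; ★ `noise_gauge` — the noise coefficients rotate:
  `ρ(h_x) σ_{e,n}(Q) ρ(h_{x+eᵢ})ᴴ = Σ_m R^{(x)}_{mn} σ_{e,m}(Q^h)`.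

With brick G1 (`isFlatBrownian_orthogonal`: the rotated noise `R W` is flat) this is the algebraic half of «`h·U` solves the SZZ system
driven by the rotated noise»; the analytic half (linearity of the characterised Itô integral in the integrator, transfer of `IsSolution`,
`lawUnique_of_start`) is brick G2/G4 of the CSU lead memo.  THEOREMS ONLY, [folklore] / [cite: ShenZhuZhu2022, §3 Lemma 3.1];
no crux or summit is proved; the Yang–Mills mass gap is NOT proved.
-/

noncomputable section

open Matrix Finset
open scoped BigOperators ComplexConjugate

namespace Summit.QuantumFields.YangMills.Theorems.ColdStartUniversality.GaugeCovariance

open Literature.MathematicalPhysics.QuantumFieldTheory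

variable {G : Type*} [Group G] [TopologicalSpace G] (r : LatticeRep G)

/-! ## §1 Unitarity of `ρ` -/

/-- `ρ(g) ρ(g)ᴴ = 1`. [folklore] -/
theorem rho_mul_conjTranspose (g : G) : r.ρ g * (r.ρ g)ᴴ = 1 := by
  have h := Matrix.mem_unitaryGroup_iff.1 (r.mem_unitary g)
  simpa [Matrix.star_eq_conjTranspose] using h

/-- `ρ(g)ᴴ ρ(g) = 1`. [folklore] -/
theorem conjTranspose_mul_rho (g : G) : (r.ρ g)ᴴ * r.ρ g = 1 := by
  have h := Matrix.mem_unitaryGroup_iff'.1 (r.mem_unitary g)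
  simpa [Matrix.star_eq_conjTranspose] using h

/-! ## §2 `Ad_{ρ(g)}` is a Hilbert–Schmidt isometry preserving `𝔤`, `𝔤^⊥`; `𝐩` is equivariant -/

/-- `Ad_{ρ(g)}` preserves the Hilbert–Schmidt form `Re tr(X Yᴴ)`. [folklore] -/
theorem hsForm_conj (g : G) (X Y : Matrix (Fin r.N) (Fin r.N) ℂ) :
    hsForm r.N (r.ρ g * X * (r.ρ g)ᴴ) (r.ρ g * Y * (r.ρ g)ᴴ) = hsForm r.N X Y := by
  simp only [hsForm_apply]
  have h1 : (r.ρ g * Y * (r.ρ g)ᴴ)ᴴ = r.ρ g * Yᴴ * (r.ρ g)ᴴ := by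
    rw [Matrix.conjTranspose_mul, Matrix.conjTranspose_mul, Matrix.conjTranspose_conjTranspose, Matrix.mul_assoc]
  rw [h1]
  have h2 : r.ρ g * X * (r.ρ g)ᴴ * (r.ρ g * Yᴴ * (r.ρ g)ᴴ) = r.ρ g * (X * Yᴴ) * (r.ρ g)ᴴ := by
    calc r.ρ g * X * (r.ρ g)ᴴ * (r.ρ g * Yᴴ * (r.ρ g)ᴴ)
        = r.ρ g * X * ((r.ρ g)ᴴ * r.ρ g) * Yᴴ * (r.ρ g)ᴴ := by simp only [Matrix.mul_assoc]
      _ = r.ρ g * (X * Yᴴ) * (r.ρ g)ᴴ := by rw [conjTranspose_mul_rho, Matrix.mul_one, Matrix.mul_assoc (r.ρ g)]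
  rw [h2, Matrix.trace_mul_cycle, conjTranspose_mul_rho, Matrix.one_mul]

/-- `Ad_{ρ(g)}` preserves the defining set of `𝔤` (`exp(t ρ(g)Xρ(g)ᴴ) = ρ(g) exp(tX) ρ(g)⁻¹ = ρ(g g' g⁻¹)`). [folklore] -/
theorem conj_mem_lieAlgCarrier {X : Matrix (Fin r.N) (Fin r.N) ℂ} (hX : X ∈ r.lieAlgCarrier) (g : G) :
    r.ρ g * X * (r.ρ g)ᴴ ∈ r.lieAlgCarrier := by
  refine ⟨?_, fun t => ?_⟩
  · have hs : star X = -X := hX.1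
    rw [Matrix.star_eq_conjTranspose] at hs ⊢
    rw [Matrix.conjTranspose_mul, Matrix.conjTranspose_mul, Matrix.conjTranspose_conjTranspose, hs,
      Matrix.neg_mul, Matrix.mul_neg, Matrix.mul_assoc]
  · obtain ⟨g', hg'⟩ := hX.2 t
    -- `ρ(g)` as a unit of the matrix ring, with inverse `ρ(g)ᴴ`
    let U : (Matrix (Fin r.N) (Fin r.N) ℂ)ˣ := ⟨r.ρ g, (r.ρ g)ᴴ, rho_mul_conjTranspose r g, conjTranspose_mul_rho r g⟩
    have key : t • (r.ρ g * X * (r.ρ g)ᴴ) =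
        (U : Matrix (Fin r.N) (Fin r.N) ℂ) * (t • X) * ((U⁻¹ : (Matrix (Fin r.N) (Fin r.N) ℂ)ˣ) : Matrix (Fin r.N) (Fin r.N) ℂ) := by
      show _ = r.ρ g * (t • X) * (r.ρ g)ᴴ
      rw [Matrix.mul_smul, Matrix.smul_mul]
    rw [key, Matrix.exp_units_conj U (t • X), ← hg']
    have rho_inv : ∀ g : G, r.ρ g⁻¹ = (r.ρ g)ᴴ := fun g =>
      calc r.ρ g⁻¹ = r.ρ g⁻¹ * (r.ρ g * (r.ρ g)ᴴ) := by rw [rho_mul_conjTranspose, mul_one]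
        _ = r.ρ (g⁻¹ * g) * (r.ρ g)ᴴ := by rw [map_mul, mul_assoc]
        _ = (r.ρ g)ᴴ := by rw [inv_mul_cancel, map_one, one_mul]
    show r.ρ g * r.ρ g' * (r.ρ g)ᴴ ∈ Set.range r.ρ
    rw [← rho_inv, ← map_mul, ← map_mul]
    exact ⟨g * g' * g⁻¹, rfl⟩

/-- `Ad_{ρ(g)}` preserves `𝔤`. [folklore] -/
theorem conj_mem_lieAlg {X : Matrix (Fin r.N) (Fin r.N) ℂ} (hX : X ∈ r.lieAlg) (g : G) :
    r.ρ g * X * (r.ρ g)ᴴ ∈ r.lieAlg := by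
  induction hX using Submodule.span_induction with
  | mem x hx => exact r.lieAlgCarrier_subset_lieAlg (conj_mem_lieAlgCarrier r hx g)
  | zero => simp
  | add x y _ _ hx hy =>
    rw [Matrix.mul_add, Matrix.add_mul]
    exact Submodule.add_mem _ hx hy
  | smul c x _ hx =>
    rw [Matrix.mul_smul, Matrix.smul_mul]
    exact Submodule.smul_mem _ c hx

/-- Undoing a conjugation: `ρ(g)ᴴ (ρ(g) X ρ(g)ᴴ) ρ(g) = X`, written with `g⁻¹`. [folklore] -/
theorem conj_inv_conj (g : G) (X : Matrix (Fin r.N) (Fin r.N) ℂ) :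
    r.ρ g⁻¹ * (r.ρ g * X * (r.ρ g)ᴴ) * (r.ρ g⁻¹)ᴴ = X := by
  have rho_inv : ∀ g : G, r.ρ g⁻¹ = (r.ρ g)ᴴ := fun g =>
    calc r.ρ g⁻¹ = r.ρ g⁻¹ * (r.ρ g * (r.ρ g)ᴴ) := by rw [rho_mul_conjTranspose, mul_one]
      _ = r.ρ (g⁻¹ * g) * (r.ρ g)ᴴ := by rw [map_mul, mul_assoc]
      _ = (r.ρ g)ᴴ := by rw [inv_mul_cancel, map_one, one_mul]
  rw [rho_inv, Matrix.conjTranspose_conjTranspose]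
  calc (r.ρ g)ᴴ * (r.ρ g * X * (r.ρ g)ᴴ) * r.ρ g
      = ((r.ρ g)ᴴ * r.ρ g) * X * ((r.ρ g)ᴴ * r.ρ g) := by simp only [Matrix.mul_assoc]
    _ = X := by rw [conjTranspose_mul_rho, Matrix.one_mul, Matrix.mul_one]

/-- `Ad_{ρ(g)}` preserves `𝔤^⊥`. [folklore] -/
theorem conj_mem_orthogonal {X : Matrix (Fin r.N) (Fin r.N) ℂ} (hX : X ∈ (hsForm r.N).orthogonal r.lieAlg) (g : G) :
    r.ρ g * X * (r.ρ g)ᴴ ∈ (hsForm r.N).orthogonal r.lieAlg := by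
  rw [LinearMap.BilinForm.mem_orthogonal_iff] at hX ⊢
  intro Y hY
  have h := hX _ (conj_mem_lieAlg r hY g⁻¹)
  -- `⟨Y, gXgᴴ⟩ = ⟨g⁻¹Yg, X⟩`
  have e : r.ρ g * (r.ρ g⁻¹ * Y * (r.ρ g⁻¹)ᴴ) * (r.ρ g)ᴴ = Y := by
    have := conj_inv_conj r g⁻¹ Y
    rwa [inv_inv] at this
  rw [← hsForm_conj r g (r.ρ g⁻¹ * Y * (r.ρ g⁻¹)ᴴ) X, e] at h
  exact h

/-- ★ **`𝐩` is `Ad`-equivariant**: `𝐩(ρ(g) X ρ(g)ᴴ) = ρ(g) 𝐩(X) ρ(g)ᴴ` (both summands of `X = 𝐩X + (X − 𝐩X)` are carried to the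
same summands). [cite: ShenZhuZhu2022, §3 (before Lemma 3.1)] -/
theorem lieProj_conj (g : G) (X : Matrix (Fin r.N) (Fin r.N) ℂ) :
    r.lieProj (r.ρ g * X * (r.ρ g)ᴴ) = r.ρ g * r.lieProj X * (r.ρ g)ᴴ := by
  have hdec : r.ρ g * X * (r.ρ g)ᴴ = r.ρ g * r.lieProj X * (r.ρ g)ᴴ + r.ρ g * (X - r.lieProj X) * (r.ρ g)ᴴ := by
    rw [← Matrix.add_mul, ← Matrix.mul_add, add_sub_cancel]
  have hp : r.ρ g * r.lieProj X * (r.ρ g)ᴴ ∈ r.lieAlg := conj_mem_lieAlg r (r.lieProj_mem X) g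
  have hq : X - r.lieProj X ∈ (hsForm r.N).orthogonal r.lieAlg := by
    rw [LatticeRep.lieProj, ← Submodule.projection_eq_self_sub_projection]
    exact Submodule.projection_apply_mem _ _
  have hq' := conj_mem_orthogonal r hq g
  rw [hdec, map_add]
  rw [show r.lieProj (r.ρ g * r.lieProj X * (r.ρ g)ᴴ) = r.ρ g * r.lieProj X * (r.ρ g)ᴴ from r.lieProj_of_mem hp]
  rw [show r.lieProj (r.ρ g * (X - r.lieProj X) * (r.ρ g)ᴴ) = 0 from
    Submodule.projection_apply_of_mem_right r.isCompl_lieAlg hq', add_zero]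

/-! ## §3 Parseval in the basis `Eₙ` and orthogonality of the `Ad` matrix -/

/-- **Parseval**: `⟨X, Y⟩ = Σₘ ⟨X, E_m⟩ ⟨Y, E_m⟩` for the canonical orthonormal basis `E_m = noiseDir m`. [folklore] -/
theorem hsForm_eq_sum {N : ℕ} (X Y : Matrix (Fin N) (Fin N) ℂ) :
    hsForm N X Y = ∑ m : NoiseIdx N, hsForm N X (noiseDir m) * hsForm N Y (noiseDir m) := by
  conv_lhs => rw [← sum_hsForm_noiseDir_smul Y]
  rw [map_sum]
  refine Finset.sum_congr rfl fun m _ => ?_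
  rw [map_smul, smul_eq_mul, mul_comm]

/-- **The `Ad` matrix is orthogonal** (column form): `Σ_m ⟨gE_ngᴴ, E_m⟩⟨gE_{n'}gᴴ, E_m⟩ = δ_{nn'}`. [folklore] -/
theorem sum_adCoeff_mul_adCoeff (g : G) (n n' : NoiseIdx r.N) :
    ∑ m : NoiseIdx r.N, hsForm r.N (r.ρ g * noiseDir n * (r.ρ g)ᴴ) (noiseDir m) *
        hsForm r.N (r.ρ g * noiseDir n' * (r.ρ g)ᴴ) (noiseDir m) = if n = n' then 1 else 0 := by
  rw [← hsForm_eq_sum, hsForm_conj, hsForm_noiseDir]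

/-- The `Ad` matrix as a `Matrix (NoiseIdx N) (NoiseIdx N) ℝ` satisfies `Rᵀ R = 1`. [folklore] -/
theorem adMatrix_transpose_mul_self (g : G) :
    (Matrix.of fun m n : NoiseIdx r.N => hsForm r.N (r.ρ g * noiseDir n * (r.ρ g)ᴴ) (noiseDir m)).transpose *
      (Matrix.of fun m n : NoiseIdx r.N => hsForm r.N (r.ρ g * noiseDir n * (r.ρ g)ᴴ) (noiseDir m)) = 1 := by
  ext n n'
  rw [Matrix.mul_apply, Matrix.one_apply]
  simp only [Matrix.transpose_apply, Matrix.of_apply]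
  exact sum_adCoeff_mul_adCoeff r g n n'

/-- Row orthogonality: `R Rᵀ = 1`, i.e. `Σ_n ⟨gE_ngᴴ, E_m⟩⟨gE_ngᴴ, E_k⟩ = δ_{mk}`. [folklore] -/
theorem sum_adCoeff_mul_adCoeff' (g : G) (m k : NoiseIdx r.N) :
    ∑ n : NoiseIdx r.N, hsForm r.N (r.ρ g * noiseDir n * (r.ρ g)ᴴ) (noiseDir m) *
        hsForm r.N (r.ρ g * noiseDir n * (r.ρ g)ᴴ) (noiseDir k) = if m = k then 1 else 0 := by
  have h := mul_eq_one_comm.mp (adMatrix_transpose_mul_self r g)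
  have h' := congrFun (congrFun h m) k
  rw [Matrix.mul_apply, Matrix.one_apply] at h'
  simpa only [Matrix.transpose_apply, Matrix.of_apply] using h'

/-- `Ad` of a basis vector expanded in the basis: `gE_ngᴴ = Σ_m R_{mn} E_m`. [folklore] -/
theorem conj_noiseDir_eq_sum (g : G) (n : NoiseIdx r.N) :
    r.ρ g * noiseDir n * (r.ρ g)ᴴ =
      ∑ m : NoiseIdx r.N, hsForm r.N (r.ρ g * noiseDir n * (r.ρ g)ᴴ) (noiseDir m) • noiseDir m :=
  (sum_hsForm_noiseDir_smul _).symm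

/-- `𝐩` of a rotated basis vector: `ρ(g) 𝐩(Eₙ) ρ(g)ᴴ = Σ_m R_{mn} 𝐩(E_m)`. [folklore] -/
theorem conj_lieProj_noiseDir (g : G) (n : NoiseIdx r.N) :
    r.ρ g * r.lieProj (noiseDir n) * (r.ρ g)ᴴ =
      ∑ m : NoiseIdx r.N, hsForm r.N (r.ρ g * noiseDir n * (r.ρ g)ᴴ) (noiseDir m) • r.lieProj (noiseDir m) := by
  rw [← lieProj_conj]
  conv_lhs => rw [conj_noiseDir_eq_sum, map_sum]
  simp only [map_smul]

/-- Orthogonal recombination of a «sum of squares»: if `Σ_n a_{mn} a_{kn} = δ_{mk}` then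
`Σ_n (Σ_m a_{mn} f_m)(Σ_k a_{kn} f_k) = Σ_m f_m f_m`. [folklore] -/
theorem sum_smul_mul_sum_smul {ι : Type*} [Fintype ι] [DecidableEq ι] {A : Type*} [Ring A] [Algebra ℝ A]
    (a : ι → ι → ℝ) (f : ι → A) (ha : ∀ m k, ∑ n, a m n * a k n = if m = k then 1 else 0) :
    ∑ n, (∑ m, a m n • f m) * (∑ k, a k n • f k) = ∑ m, f m * f m := by
  calc ∑ n, (∑ m, a m n • f m) * (∑ k, a k n • f k)
      = ∑ n, ∑ m, ∑ k, (a m n * a k n) • (f m * f k) := by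
        refine Finset.sum_congr rfl fun n _ => ?_
        rw [Finset.sum_mul]
        refine Finset.sum_congr rfl fun m _ => ?_
        rw [Finset.mul_sum]
        refine Finset.sum_congr rfl fun k _ => ?_
        rw [smul_mul_assoc, mul_smul_comm, smul_smul]
    _ = ∑ m, ∑ k, (∑ n, a m n * a k n) • (f m * f k) := by
        rw [Finset.sum_comm]
        refine Finset.sum_congr rfl fun m _ => ?_
        rw [Finset.sum_comm]
        refine Finset.sum_congr rfl fun k _ => ?_
        rw [Finset.sum_smul]
    _ = ∑ m, f m * f m := by
        refine Finset.sum_congr rfl fun m _ => ?_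
        simp_rw [ha]
        simp [ite_smul, Finset.sum_ite_eq]

/-- ★ **The Casimir matrix is `Ad`-invariant**: `ρ(g) C_𝔤 ρ(g)ᴴ = C_𝔤`. [folklore] -/
theorem casimir_conj (g : G) : r.ρ g * r.casimir * (r.ρ g)ᴴ = r.casimir := by
  classical
  unfold LatticeRep.casimir
  rw [Finset.mul_sum, Finset.sum_mul]
  have step : ∀ n : NoiseIdx r.N,
      r.ρ g * (r.lieProj (noiseDir n) * r.lieProj (noiseDir n)) * (r.ρ g)ᴴ =
        (r.ρ g * r.lieProj (noiseDir n) * (r.ρ g)ᴴ) * (r.ρ g * r.lieProj (noiseDir n) * (r.ρ g)ᴴ) := by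
    intro n
    calc r.ρ g * (r.lieProj (noiseDir n) * r.lieProj (noiseDir n)) * (r.ρ g)ᴴ
        = r.ρ g * r.lieProj (noiseDir n) * ((r.ρ g)ᴴ * r.ρ g) * r.lieProj (noiseDir n) * (r.ρ g)ᴴ := by
          rw [conjTranspose_mul_rho, Matrix.mul_one]; simp only [Matrix.mul_assoc]
      _ = _ := by simp only [Matrix.mul_assoc]
  simp_rw [step, conj_lieProj_noiseDir]
  exact sum_smul_mul_sum_smul (fun m n => hsForm r.N (r.ρ g * noiseDir n * (r.ρ g)ᴴ) (noiseDir m))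
    (fun m => r.lieProj (noiseDir m)) (sum_adCoeff_mul_adCoeff' r g)

/-! ## §4 Gauge covariance of the SZZ data -/

section Gauge

variable {d L : ℕ}

/-- Lattice steps commute: `(x + eᵢ) + eⱼ = (x + eⱼ) + eᵢ`. [folklore] -/
theorem shift_shift_comm (x : Literature.MathematicalPhysics.QuantumFieldTheory.Site d L) (i j : Fin d) :
    (x.shift i).shift j = (x.shift j).shift i := by
  simp only [Literature.MathematicalPhysics.QuantumFieldTheory.Site.shift]
  exact add_right_comm _ _ _

/-- `(x − eⱼ) + eⱼ = x`. [folklore] -/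
theorem sub_single_shift (x : Literature.MathematicalPhysics.QuantumFieldTheory.Site d L) (j : Fin d) :
    (x - Pi.single j (1 : ZMod L)).shift j = x := by
  simp only [Literature.MathematicalPhysics.QuantumFieldTheory.Site.shift, sub_add_cancel]

/-- `((x − eⱼ) + eᵢ) + eⱼ = x + eᵢ`. [folklore] -/
theorem sub_single_shift_shift (x : Literature.MathematicalPhysics.QuantumFieldTheory.Site d L) (i j : Fin d) :
    ((x - Pi.single j (1 : ZMod L)).shift i).shift j = x.shift i := by
  rw [shift_shift_comm, sub_single_shift]

/-- Telescoping of a gauge-conjugated 4-chain: `(u_x A u_aᴴ)(u_a B u_bᴴ)(u_b C u_cᴴ)(u_c D u_xᴴ) = u_x (ABCD) u_xᴴ`. [folklore] -/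
theorem conj_chain4 {N : ℕ} (ux ua ub uc A B C D : Matrix (Fin N) (Fin N) ℂ)
    (ha : uaᴴ * ua = 1) (hb : ubᴴ * ub = 1) (hc : ucᴴ * uc = 1) :
    ux * A * uaᴴ * (ua * B * ubᴴ) * (ub * C * ucᴴ) * (uc * D * uxᴴ) = ux * (A * B * C * D) * uxᴴ := by
  calc ux * A * uaᴴ * (ua * B * ubᴴ) * (ub * C * ucᴴ) * (uc * D * uxᴴ)
      = ux * A * (uaᴴ * ua) * B * (ubᴴ * ub) * C * (ucᴴ * uc) * D * uxᴴ := by simp only [Matrix.mul_assoc]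
    _ = ux * (A * B * C * D) * uxᴴ := by rw [ha, hb, hc]; simp only [Matrix.mul_one, Matrix.mul_assoc]

variable (h : Literature.MathematicalPhysics.QuantumFieldTheory.Site d L → G)

/-- ★ **The rooted plaquette loops are gauge covariant**: under `Q_e ↦ ρ(h_x) Q_e ρ(h_{x+e})ᴴ` the loops rooted at `e = (x,i)` are
conjugated by `ρ(h_x)`. [cite: ShenZhuZhu2022, §3 (before Lemma 3.1)] -/
theorem rootedLoop_gauge (Q : MatrixConfig d L r.N) (e : Edge d L) (j : Fin d) (b : Bool) :
    rootedLoop (fun e' : Edge d L => r.ρ (h e'.1) * Q e' * (r.ρ (h (e'.1.shift e'.2)))ᴴ) e j b =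
      r.ρ (h e.1) * rootedLoop Q e j b * (r.ρ (h e.1))ᴴ := by
  obtain ⟨x, i⟩ := e
  cases b with
  | false =>
    simp only [rootedLoop, Matrix.conjTranspose_mul, Matrix.conjTranspose_conjTranspose]
    rw [shift_shift_comm x j i]
    have key := conj_chain4 (r.ρ (h x)) (r.ρ (h (x.shift i))) (r.ρ (h ((x.shift i).shift j))) (r.ρ (h (x.shift j)))
      (Q (x, i)) (Q (x.shift i, j)) ((Q (x.shift j, i))ᴴ) ((Q (x, j))ᴴ)
      (conjTranspose_mul_rho r _) (conjTranspose_mul_rho r _) (conjTranspose_mul_rho r _)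
    simp only [Matrix.mul_assoc] at key ⊢
    exact key
  | true =>
    simp only [rootedLoop, Matrix.conjTranspose_mul, Matrix.conjTranspose_conjTranspose]
    rw [sub_single_shift_shift x i j, sub_single_shift x j]
    have key := conj_chain4 (r.ρ (h x)) (r.ρ (h (x.shift i))) (r.ρ (h ((x - Pi.single j (1 : ZMod L)).shift i)))
      (r.ρ (h (x - Pi.single j (1 : ZMod L))))
      (Q (x, i)) ((Q ((x - Pi.single j (1 : ZMod L)).shift i, j))ᴴ) ((Q (x - Pi.single j (1 : ZMod L), i))ᴴ)
      (Q (x - Pi.single j (1 : ZMod L), j))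
      (conjTranspose_mul_rho r _) (conjTranspose_mul_rho r _) (conjTranspose_mul_rho r _)
    simp only [Matrix.mul_assoc] at key ⊢
    exact key

/-- **The Lie drift is gauge covariant**: `driftLie(Q^h)_e = ρ(h_x) driftLie(Q)_e ρ(h_x)ᴴ`. [cite: ShenZhuZhu2022, §3 Lemma 3.1] -/
theorem driftLie_gauge (β : ℝ) (Q : MatrixConfig d L r.N) (e : Edge d L) :
    r.driftLie β (fun e' : Edge d L => r.ρ (h e'.1) * Q e' * (r.ρ (h (e'.1.shift e'.2)))ᴴ) e =
      r.ρ (h e.1) * r.driftLie β Q e * (r.ρ (h e.1))ᴴ := by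
  unfold LatticeRep.driftLie
  rw [Matrix.mul_smul, Matrix.smul_mul, Finset.mul_sum, Finset.sum_mul]
  congr 1
  refine Finset.sum_congr rfl fun j _ => ?_
  rw [Finset.mul_sum, Finset.sum_mul]
  refine Finset.sum_congr rfl fun b _ => ?_
  rw [rootedLoop_gauge, Matrix.conjTranspose_mul, Matrix.conjTranspose_mul, Matrix.conjTranspose_conjTranspose,
    ← Matrix.mul_assoc, lieProj_conj]

/-- ★ **The SZZ drift is gauge covariant**: `b_e(Q^h) = ρ(h_x) b_e(Q) ρ(h_{x+eᵢ})ᴴ` (Lie drift conjugated, Casimir `Ad`-invariant).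
[cite: ShenZhuZhu2022, §3 Lemma 3.1] -/
theorem drift_gauge (β : ℝ) (Q : MatrixConfig d L r.N) (e : Edge d L) :
    (latticeLangevinDynamics r β).drift (fun e' : Edge d L => r.ρ (h e'.1) * Q e' * (r.ρ (h (e'.1.shift e'.2)))ᴴ) e =
      r.ρ (h e.1) * (latticeLangevinDynamics r β).drift Q e * (r.ρ (h (e.1.shift e.2)))ᴴ := by
  simp only [latticeLangevinDynamics_drift]
  rw [driftLie_gauge]
  conv_lhs => rw [← casimir_conj r (h e.1)]
  rw [← Matrix.add_mul, ← Matrix.mul_add]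
  calc r.ρ (h e.1) * (r.driftLie β Q e + r.casimir) * (r.ρ (h e.1))ᴴ *
        (r.ρ (h e.1) * Q e * (r.ρ (h (e.1.shift e.2)))ᴴ)
      = r.ρ (h e.1) * (r.driftLie β Q e + r.casimir) * ((r.ρ (h e.1))ᴴ * r.ρ (h e.1)) * Q e *
          (r.ρ (h (e.1.shift e.2)))ᴴ := by simp only [Matrix.mul_assoc]
    _ = r.ρ (h e.1) * ((r.driftLie β Q e + r.casimir) * Q e) * (r.ρ (h (e.1.shift e.2)))ᴴ := by
          rw [conjTranspose_mul_rho, Matrix.mul_one]; simp only [Matrix.mul_assoc]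

/-- ★ **The SZZ noise coefficients rotate under the gauge action**:
`ρ(h_x) σ_{e,n}(Q) ρ(h_{x+eᵢ})ᴴ = Σ_m R^{(x)}_{mn} σ_{e,m}(Q^h)` with the orthogonal matrix `R^{(x)}_{mn} = ⟨ρ(h_x)Eₙρ(h_x)ᴴ, E_m⟩`.
[cite: ShenZhuZhu2022, §3 (the SDE system after Lemma 3.1)] -/
theorem noise_gauge (β : ℝ) (Q : MatrixConfig d L r.N) (e : Edge d L) (n : NoiseIdx r.N) :
    r.ρ (h e.1) * (latticeLangevinDynamics r β).noise Q e n * (r.ρ (h (e.1.shift e.2)))ᴴ =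
      ∑ m : NoiseIdx r.N, hsForm r.N (r.ρ (h e.1) * noiseDir n * (r.ρ (h e.1))ᴴ) (noiseDir m) •
        (latticeLangevinDynamics r β).noise (fun e' : Edge d L => r.ρ (h e'.1) * Q e' * (r.ρ (h (e'.1.shift e'.2)))ᴴ) e m := by
  simp only [latticeLangevinDynamics_noise]
  have h1 : r.ρ (h e.1) * ((Real.sqrt 2 : ℂ) • (r.lieProj (noiseDir n) * Q e)) * (r.ρ (h (e.1.shift e.2)))ᴴ =
      (Real.sqrt 2 : ℂ) • ((r.ρ (h e.1) * r.lieProj (noiseDir n) * (r.ρ (h e.1))ᴴ) *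
        (r.ρ (h e.1) * Q e * (r.ρ (h (e.1.shift e.2)))ᴴ)) := by
    rw [Matrix.mul_smul, Matrix.smul_mul]
    congr 1
    calc r.ρ (h e.1) * (r.lieProj (noiseDir n) * Q e) * (r.ρ (h (e.1.shift e.2)))ᴴ
        = r.ρ (h e.1) * r.lieProj (noiseDir n) * ((r.ρ (h e.1))ᴴ * r.ρ (h e.1)) * Q e * (r.ρ (h (e.1.shift e.2)))ᴴ := by
          rw [conjTranspose_mul_rho, Matrix.mul_one]; simp only [Matrix.mul_assoc]
      _ = _ := by simp only [Matrix.mul_assoc]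
  rw [h1, conj_lieProj_noiseDir, Finset.sum_mul, Finset.smul_sum]
  refine Finset.sum_congr rfl fun m _ => ?_
  rw [Matrix.smul_mul, smul_comm]

end Gauge

end Summit.QuantumFields.YangMills.Theorems.ColdStartUniversality.GaugeCovariance

end
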